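import Literature.Geometry.ComplexHyperbolic.UnitBallFrameTransport    -- ★ `flowRot_mul_conjTranspose_self`, `flowRot_mul_J`, `conj_smul_eq`
import HarnessLib

/-!
# The value at the centre of `U(2,1)`, (A4-iii): `K`-conjugation invariance (matrix form) supplies the two flow invariances of the assembly, also for `Ψ = Θ ∘ (ζ • ·)`
# (Goldman 1999 §3.1.1; Helgason 2000 Ch. II §4)

Topic `Geometry/ComplexHyperbolic`; namespace `Literature.Geometry.ComplexHyperbolic.BallModel`.  THEOREMS ONLY (no `def`, no instance, no notation, no axiom, no named fact,
no `sorry`).  Cell `pub/hodgecm-mathlib`, ENGINE T1 (crux H413 = `stmt-HodgeConjecture-24833`); ROAD A, (A4-iii) «THE VALUE», glue for the hypotheses `hKA`, `hKB` of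
★ `centreValue_assembly_ang_null` ∕ the total assembly: a test function invariant under every unitary `κ` commuting with `J` (the matrix form of `Stab(x₀) = U(2)×U(1)`-conjugation
invariance, cf. ★ p05 `UnitBallOrbitalKAverage`) is invariant under the unitary flows `ρ_u(θ)` of ★ `UnitBallFrameTransport` (`|u| = 1`), and so is `X ↦ Θ(c • X)`; the two
instances `u = −1`, `u = −i` are spelled out in the exact token form the assembly files use.  Author F0P3a-p06 (g12), 2026-09-01.
HONEST LABEL: HC_CM is proved only modulo the printed citations until rung 0 closes; glue, pays nothing by itself.

## References
* [Goldman1999] W. M. Goldman, *Complex Hyperbolic Geometry* (1999), §3.1.1–3.1.2.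
* [Helgason2000] S. Helgason, *Groups and Geometric Analysis* (2000), Ch. II §4.
-/

noncomputable section

open Matrix Complex
open scoped Matrix.Norms.Operator ComplexConjugate

namespace Literature.Geometry.ComplexHyperbolic.BallModel

variable {G : Type*}

/-- **`K`-INVARIANCE ⇒ FLOW INVARIANCE**: for `|u| = 1`, `Θ(ρ_u(θ)·X·ρ_u(θ)ᴴ) = Θ(X)`. [cite: Goldman1999, §3.1.1–3.1.2] -/
theorem flow_invariant_of_kInvariant (Θ : Matrix (Fin 3) (Fin 3) ℂ → G)
    (hK : ∀ κ : Matrix (Fin 3) (Fin 3) ℂ, κ * κᴴ = 1 → κ * J = J * κ → ∀ X, Θ (κ * X * κᴴ) = Θ X) (u : ℂ) (hu : star u * u = 1) (θ : ℝ) (X : Matrix (Fin 3) (Fin 3) ℂ) :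
    Θ ((!![(Real.cos θ : ℂ), star u * (Real.sin θ : ℂ), 0; -(u * (Real.sin θ : ℂ)), (Real.cos θ : ℂ), 0; 0, 0, 1] : Matrix (Fin 3) (Fin 3) ℂ) * X * (!![(Real.cos θ : ℂ), star u * (Real.sin θ : ℂ), 0; -(u * (Real.sin θ : ℂ)), (Real.cos θ : ℂ), 0; 0, 0, 1] : Matrix (Fin 3) (Fin 3) ℂ)ᴴ) = Θ X :=
  hK _ (flowRot_mul_conjTranspose_self u hu θ) (flowRot_mul_J u θ) X

/-- Flow invariance passes to `X ↦ Θ(c • X)` (`c • (ρXρᴴ) = ρ(c • X)ρᴴ`). [cite: Goldman1999, §3.1.1] -/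
theorem flow_invariant_comp_smul (Θ : Matrix (Fin 3) (Fin 3) ℂ → G) (c u : ℂ)
    (h : ∀ (θ : ℝ) (X : Matrix (Fin 3) (Fin 3) ℂ), Θ ((!![(Real.cos θ : ℂ), star u * (Real.sin θ : ℂ), 0; -(u * (Real.sin θ : ℂ)), (Real.cos θ : ℂ), 0; 0, 0, 1] : Matrix (Fin 3) (Fin 3) ℂ) * X * (!![(Real.cos θ : ℂ), star u * (Real.sin θ : ℂ), 0; -(u * (Real.sin θ : ℂ)), (Real.cos θ : ℂ), 0; 0, 0, 1] : Matrix (Fin 3) (Fin 3) ℂ)ᴴ) = Θ X) (θ : ℝ) (X : Matrix (Fin 3) (Fin 3) ℂ) :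
    (fun Y : Matrix (Fin 3) (Fin 3) ℂ => Θ (c • Y)) ((!![(Real.cos θ : ℂ), star u * (Real.sin θ : ℂ), 0; -(u * (Real.sin θ : ℂ)), (Real.cos θ : ℂ), 0; 0, 0, 1] : Matrix (Fin 3) (Fin 3) ℂ) * X * (!![(Real.cos θ : ℂ), star u * (Real.sin θ : ℂ), 0; -(u * (Real.sin θ : ℂ)), (Real.cos θ : ℂ), 0; 0, 0, 1] : Matrix (Fin 3) (Fin 3) ℂ)ᴴ) = (fun Y : Matrix (Fin 3) (Fin 3) ℂ => Θ (c • Y)) X := by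
  simp only [← conj_smul_eq]
  exact h θ (c • X)

/-- The instance `u = −1` (generator `X̃_A = E₁₀ − E₀₁` of the assembly files), for `Ψ = Θ ∘ (c • ·)`. [cite: Helgason2000, Ch. II §4] -/
theorem flow_invariant_negOne_of_kInvariant (Θ : Matrix (Fin 3) (Fin 3) ℂ → G)
    (hK : ∀ κ : Matrix (Fin 3) (Fin 3) ℂ, κ * κᴴ = 1 → κ * J = J * κ → ∀ X, Θ (κ * X * κᴴ) = Θ X) (c : ℂ) :
    ∀ (θ : ℝ) (X : Matrix (Fin 3) (Fin 3) ℂ), (fun Y : Matrix (Fin 3) (Fin 3) ℂ => Θ (c • Y)) ((!![(Real.cos θ : ℂ), star (-1 : ℂ) * (Real.sin θ : ℂ), 0; -((-1 : ℂ) * (Real.sin θ : ℂ)), (Real.cos θ : ℂ), 0; 0, 0, 1] : Matrix (Fin 3) (Fin 3) ℂ) * X * (!![(Real.cos θ : ℂ), star (-1 : ℂ) * (Real.sin θ : ℂ), 0; -((-1 : ℂ) * (Real.sin θ : ℂ)), (Real.cos θ : ℂ), 0; 0, 0, 1] : Matrix (Fin 3) (Fin 3) ℂ)ᴴ) = (fun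 Y : Matrix (Fin 3) (Fin 3) ℂ => Θ (c • Y)) X :=
  fun θ X => flow_invariant_comp_smul Θ c (-1 : ℂ) (fun θ' X' => flow_invariant_of_kInvariant Θ hK (-1 : ℂ) (by simp) θ' X') θ X

/-- The instance `u = −i` (generator `X̃_B = i(E₀₁ + E₁₀)` of the assembly files), for `Ψ = Θ ∘ (c • ·)`. [cite: Helgason2000, Ch. II §4] -/
theorem flow_invariant_negI_of_kInvariant (Θ : Matrix (Fin 3) (Fin 3) ℂ → G)
    (hK : ∀ κ : Matrix (Fin 3) (Fin 3) ℂ, κ * κᴴ = 1 → κ * J = J * κ → ∀ X, Θ (κ * X * κᴴ) = Θ X) (c : ℂ) :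
    ∀ (θ : ℝ) (X : Matrix (Fin 3) (Fin 3) ℂ), (fun Y : Matrix (Fin 3) (Fin 3) ℂ => Θ (c • Y)) ((!![(Real.cos θ : ℂ), star (-Complex.I) * (Real.sin θ : ℂ), 0; -((-Complex.I) * (Real.sin θ : ℂ)), (Real.cos θ : ℂ), 0; 0, 0, 1] : Matrix (Fin 3) (Fin 3) ℂ) * X * (!![(Real.cos θ : ℂ), star (-Complex.I) * (Real.sin θ : ℂ), 0; -((-Complex.I) * (Real.sin θ : ℂ)), (Real.cos θ : ℂ), 0; 0, 0, 1] : Matrix (Fin 3) (Fin 3) ℂ)ᴴ) = (fun Y : Matrix (Fin 3) (Fin 3) ℂ => Θ (c • Y)) X :=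
  fun θ X => flow_invariant_comp_smul Θ c (-Complex.I) (fun θ' X' => flow_invariant_of_kInvariant Θ hK (-Complex.I) (by simp) θ' X') θ X

end Literature.Geometry.ComplexHyperbolic.BallModel

end
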